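import Literature.NumberTheory.Automorphic.HidaTowerLevels
import Literature.NumberTheory.Automorphic.TameLevelScalarFactorisation
import Literature.NumberTheory.Automorphic.CompletedCohomology
import HarnessLib

/-!
# `U_v` is multiplicative at Iwahori level: `[U t_{v,1}^a U] ∘ [U t_{v,1}^b U] = [U t_{v,1}^{a+b} U]`

Topic `NumberTheory/Automorphic`; namespaces `Literature.NumberTheory.Automorphic.ArithmeticQuotient`
(generic) and `…BigHeckeGLn.TameLevel` (`GL₂`); theorems only.  Proof file supporting the named
fact `hidaControl_dominantOrdinaryPoint`: it links the operator `U_v^{(r)} = [U t_{v,1}^r U]` used in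
independence of weight (`HidaIndependenceOfWeightGL2`, `HidaIndependenceOfWeightTower`:
[KhareThorne2017, §6.4, Prop. 6.13]) with the `r`-th power of the tree's `U_{v,1} = [U t_{v,1} U]`
(the operator whose ordinary part the fact speaks about) at the Iwahori levels `U(b,c)` of the
`GL₂` Hida family.

* `ArithmeticQuotient.heckeFun_comp_heckeFun` — **generic criterion `T_g ∘ T_{g'} = T_{gg'}`** on
  `Fun(𝒢 ⧸ L, M)`: it suffices that `g L g' ⊆ L g g' L` and that `y • e = y' • e'`
  (`y, y' ∈ LgL`, `e, e' ∈ Lg'L/L`) forces `yL = y'L` — then `(d, e) ↦ d̃ • e` is a bijection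
  `LgL/L × Lg'L/L → Lgg'L/L` and the double sum re-indexes (Shimura's `deg` multiplicativity).
* The `GL₂` Iwahori coset calculus at `v ∣ p` for `U = U(b,c)` (`U` maximal above `p`, `b ≤ c`):
  `localUnipotent`, `globalUnipotent` (`N(x) = ι_v(1 x; 0 1)`), `cutDiag_mul_localUnipotent`
  (`t^a n(x) = n(ϖ^a x) t^a`), `exists_globalUnipotent_coset_eq` (**every coset of `U t^a U / U` is
  `N(x) t^a U`**, `a ≤ c`, from the Iwahori factorisation `exists_unipotent_cutDiag_conj_mem`),
  `globalUnipotent_coset_eq_iff` (`N(x) t^a U = N(x') t^a U ↔ v(x − x') ≤ |ϖ|^a`).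
* `TameLevel.heckeFun_level_heckeElement_pow_comp` — **`[U t^a U] ∘ [U t^b U] = [U t^{a+b} U]` on
  `Fun(𝒢 ⧸ U(b,c), M)` for `a + b ≤ c`**; `heckeEnd_level_heckeElement_pow` — **on
  `H^i(X_{U(b,c)}, M)`, `heckeEnd (t_{v,1}^r) = (heckeEnd t_{v,1})^r` for `r ≤ c`.**

## References

* G. Shimura, *Introduction to the arithmetic theory of automorphic functions* (1971), Ch. 3,
  Prop. 3.1–3.3 (degree of double cosets; composition in the Hecke ring). [ShimuraIATAF1971]
* C. Khare, J. A. Thorne, *Potential automorphy and the Leopoldt conjecture*, Amer. J. Math. 139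
  (2017), §6.2 and §6.4 (arXiv:1409.7007, held). [KhareThorne2017]
* H. Hida, *p-adic ordinary Hecke algebras for GL(2)*, Ann. Inst. Fourier 44 (1994), §2 (held).
  [Hida1994AIF]
-/

noncomputable section

open CategoryTheory IsDedekindDomain NumberField

universe u

namespace Literature.NumberTheory.Automorphic

/-! ### Generic: `T_g ∘ T_{g'} = T_{g g'}` -/

namespace ArithmeticQuotient

variable (k : Type u) [CommRing k] {𝒢 : Type u} [Group 𝒢] (L : Subgroup 𝒢) (M : Type u)
  [AddCommGroup M] [Module k M]

/-- Every coset in `L g L / L` is `(l g) L` for some `l ∈ L`. [folklore] -/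
theorem exists_coe_mul_eq_of_mem_doubleCosetQuot {g : 𝒢} {d : 𝒢 ⧸ L}
    (hd : d ∈ doubleCosetQuot L g) : ∃ l ∈ L, ((l * g : 𝒢) : 𝒢 ⧸ L) = d := by
  obtain ⟨l, rfl⟩ := hd
  exact ⟨l, l.2, rfl⟩

open scoped Classical in
/-- **`T_g ∘ T_{g'} = T_{g g'}` on `Fun(𝒢 ⧸ L, M)`** as soon as `g L g' ⊆ L g g' L` and the map
`(y, e) ↦ y • e`, `y ∈ L g L`, `e ∈ L g' L / L`, separates the cosets `yL`: then
`(d, e) ↦ d̃ • e` is a bijection `LgL/L × Lg'L/L ≃ Lgg'L/L` and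
`∑_d ∑_e f(x d̃ • e) = ∑_c f(x • c)`. [cite: ShimuraIATAF1971, Ch. 3, Prop. 3.3] -/
theorem heckeFun_comp_heckeFun {g g' : 𝒢} (hfin : (doubleCosetQuot L g).Finite)
    (hfin' : (doubleCosetQuot L g').Finite) (hfin'' : (doubleCosetQuot L (g * g')).Finite)
    (hmul : ∀ l ∈ L, ((g * l * g' : 𝒢) : 𝒢 ⧸ L) ∈ doubleCosetQuot L (g * g'))
    (hinj : ∀ y y' : 𝒢, (y : 𝒢 ⧸ L) ∈ doubleCosetQuot L g → (y' : 𝒢 ⧸ L) ∈ doubleCosetQuot L g →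
      ∀ e ∈ doubleCosetQuot L g', ∀ e' ∈ doubleCosetQuot L g',
        y • e = y' • e' → (y : 𝒢 ⧸ L) = (y' : 𝒢 ⧸ L)) :
    heckeFun k L g M ∘ₗ heckeFun k L g' M = heckeFun k L (g * g') M := by
  refine LinearMap.ext fun f => funext fun c => ?_
  induction c using QuotientGroup.induction_on with
  | H x =>
    rw [LinearMap.comp_apply, heckeFun_apply_coe k L M g _ x hfin,
      heckeFun_apply_coe k L M (g * g') f x hfin'']
    have hd : ∀ d ∈ hfin.toFinset, heckeFun k L g' M f (x • d) =
        ∑ e ∈ hfin'.toFinset, f (x • (d.out • e)) := by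
      intro d _
      have hxd : x • d = ((x * d.out : 𝒢) : 𝒢 ⧸ L) := by
        conv_lhs => rw [← QuotientGroup.out_eq' d]
        rfl
      rw [hxd, heckeFun_apply_coe k L M g' f (x * d.out) hfin']
      simp_rw [mul_smul]
    rw [Finset.sum_congr rfl hd, ← Finset.sum_product']
    -- re-index along `(d, e) ↦ d.out • e`
    refine Finset.sum_bij (fun q _ => q.1.out • q.2) (fun q hq => ?_) (fun q hq q' hq' he => ?_)
      (fun c hc => ?_) (fun q _ => rfl)
    · -- lands in `L g g' L / L`
      rw [Finset.mem_product, Set.Finite.mem_toFinset, Set.Finite.mem_toFinset] at hq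
      rw [Set.Finite.mem_toFinset]
      obtain ⟨l, hl, hld⟩ := exists_coe_mul_eq_of_mem_doubleCosetQuot L hq.1
      obtain ⟨u, hu⟩ := QuotientGroup.mk_out_eq_mul L (l * g)
      obtain ⟨l', hl', hle⟩ := exists_coe_mul_eq_of_mem_doubleCosetQuot L hq.2
      have hout : q.1.out = l * g * u := by rw [← hu, hld]
      rw [hout, ← hle]
      have : ((l * g * u : 𝒢) • ((l' * g' : 𝒢) : 𝒢 ⧸ L)) =
          (⟨l, hl⟩ : L) • (((g * (u * l') * g' : 𝒢)) : 𝒢 ⧸ L) := by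
        rw [MulAction.Quotient.smul_coe, smul_eq_mul]
        change _ = (((l : 𝒢) • ((g * (u * l') * g' : 𝒢) : 𝒢 ⧸ L)))
        rw [MulAction.Quotient.smul_coe, smul_eq_mul]
        congr 1
        group
      rw [this]
      exact coe_smul_mem_doubleCosetQuot (hmul _ (L.mul_mem u.2 hl')) ⟨l, hl⟩
    · -- injective
      rw [Finset.mem_product, Set.Finite.mem_toFinset, Set.Finite.mem_toFinset] at hq hq'
      have h1 : (q.1.out : 𝒢 ⧸ L) = (q'.1.out : 𝒢 ⧸ L) :=
        hinj _ _ (by rw [QuotientGroup.out_eq']; exact hq.1) (by rw [QuotientGroup.out_eq']; exact hq'.1)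
          _ hq.2 _ hq'.2 he
      rw [QuotientGroup.out_eq', QuotientGroup.out_eq'] at h1
      have h2 : q.2 = q'.2 := by
        have he' : q.1.out • q.2 = q.1.out • q'.2 := by
          have h := he
          rwa [show q'.1 = q.1 from h1.symm] at h
        exact (smul_left_cancel_iff _).1 he'
      exact Prod.ext h1 h2
    · -- surjective
      rw [Set.Finite.mem_toFinset] at hc
      obtain ⟨l, hl, hlc⟩ := exists_coe_mul_eq_of_mem_doubleCosetQuot L hc
      obtain ⟨u, hu⟩ := QuotientGroup.mk_out_eq_mul L (l * g)
      refine ⟨(((l * g : 𝒢) : 𝒢 ⧸ L), (((u : 𝒢)⁻¹ * g' : 𝒢) : 𝒢 ⧸ L)), ?_, ?_⟩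
      · rw [Finset.mem_product, Set.Finite.mem_toFinset, Set.Finite.mem_toFinset]
        exact ⟨⟨⟨l, hl⟩, rfl⟩, ⟨⟨(u : 𝒢)⁻¹, L.inv_mem u.2⟩, rfl⟩⟩
      · change (((l * g : 𝒢) : 𝒢 ⧸ L)).out • ((((u : 𝒢)⁻¹ * g' : 𝒢)) : 𝒢 ⧸ L) = c
        rw [hu, MulAction.Quotient.smul_coe, smul_eq_mul, ← hlc]
        congr 1
        group

end ArithmeticQuotient

/-! ### The local unipotent `n(x) = (1 x; 0 1)` and the cut torus element `diag(ϖ^a, 1)` -/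

namespace BigHeckeGLn

variable {K : Type} [Field K] [NumberField K] (v : HeightOneSpectrum (𝓞 K))

/-- **The local unipotent `n(x) = (1 x; 0 1) ∈ GL₂(K_v)`** (`unipotentOfSqZero` of the tree, as in
`HidaTowerDegreeZeroOrdinary`). [folklore] -/
def localUnipotent (x : v.adicCompletion K) : GL (Fin 2) (v.adicCompletion K) :=
  unipotentOfSqZero (Matrix.single (0 : Fin 2) (1 : Fin 2) x)
    (Matrix.single_mul_single_of_ne x 0 1 0 (by decide) x)

/-- The matrix of `n(x)` is `1 + x E₀₁`. [folklore] -/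
@[simp]
theorem coe_localUnipotent (x : v.adicCompletion K) :
    (localUnipotent v x : Matrix (Fin 2) (Fin 2) (v.adicCompletion K)) =
      1 + Matrix.single (0 : Fin 2) (1 : Fin 2) x :=
  rfl

/-- `n(x) n(y) = n(x + y)`. [folklore] -/
theorem localUnipotent_mul (x y : v.adicCompletion K) :
    localUnipotent v x * localUnipotent v y = localUnipotent v (x + y) := by
  refine Matrix.GeneralLinearGroup.ext fun i j => ?_
  rw [Matrix.GeneralLinearGroup.coe_mul, coe_localUnipotent, coe_localUnipotent, coe_localUnipotent,
    add_mul, one_mul, mul_add, mul_one, Matrix.single_mul_single_of_ne x 0 1 0 (by decide) y]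
  simp [Matrix.add_apply, Matrix.single_apply, add_assoc]
  split_ifs <;> ring

/-- `n(0) = 1`. [folklore] -/
@[simp]
theorem localUnipotent_zero : localUnipotent v 0 = 1 :=
  Matrix.GeneralLinearGroup.ext fun i j => by
    rw [coe_localUnipotent, Matrix.single_zero, add_zero, Units.val_one]

/-- `n(x)⁻¹ = n(-x)`. [folklore] -/
theorem localUnipotent_inv (x : v.adicCompletion K) : (localUnipotent v x)⁻¹ = localUnipotent v (-x) :=
  inv_eq_of_mul_eq_one_right (by rw [localUnipotent_mul, add_neg_cancel, localUnipotent_zero])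

/-- **`diag(w, 1) n(x) = n(w x) diag(w, 1)`.** [folklore] -/
theorem cutDiag_mul_localUnipotent (w : (v.adicCompletion K)ˣ) (x : v.adicCompletion K) :
    cutDiag w 1 * localUnipotent v x = localUnipotent v ((w : v.adicCompletion K) * x) * cutDiag w 1 := by
  refine Matrix.GeneralLinearGroup.ext fun i j => ?_
  rw [Matrix.GeneralLinearGroup.coe_mul, Matrix.GeneralLinearGroup.coe_mul, coe_localUnipotent,
    coe_localUnipotent, cutDiag, coe_glDiagonal, Matrix.diagonal_mul, Matrix.mul_diagonal]
  fin_cases i <;> fin_cases j <;> simp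

/-- **`diag(w,1)⁻¹ n(x) diag(w,1) = n(w⁻¹ x)`.** [folklore] -/
theorem cutDiag_inv_mul_localUnipotent_mul_cutDiag (w : (v.adicCompletion K)ˣ) (x : v.adicCompletion K) :
    (cutDiag w 1)⁻¹ * localUnipotent v x * cutDiag w 1 =
      localUnipotent v (((w⁻¹ : (v.adicCompletion K)ˣ) : v.adicCompletion K) * x) := by
  rw [mul_assoc, inv_mul_eq_iff_eq_mul, cutDiag_mul_localUnipotent, ← mul_assoc, Units.mul_inv, one_mul]

/-- Powers of the cut torus element: `diag(w, 1)^a = diag(w^a, 1)`. [folklore] -/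
theorem cutDiag_one_pow (w : (v.adicCompletion K)ˣ) (a : ℕ) :
    (cutDiag w 1 : GL (Fin 2) (v.adicCompletion K)) ^ a = cutDiag (w ^ a) 1 := by
  rw [cutDiag, cutDiag, ← map_pow]
  congr 1
  funext l
  simp only [Pi.pow_apply]
  split_ifs
  · rfl
  · exact one_pow a

/-- `n(x) ∈ Iw_v(β, γ)` iff `x` is integral. [folklore] -/
theorem localUnipotent_mem_valuedIwahoriSubgroup_iff (x : v.adicCompletion K)
    (β γ : WithZero (Multiplicative ℤ)) :
    localUnipotent v x ∈ valuedIwahoriSubgroup (Fin 2) β γ ↔ Valued.v x ≤ 1 := by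
  constructor
  · intro h
    simpa [Matrix.single_apply] using h.1.le_one 0 1
  · intro hx
    have hcond : ∀ c : v.adicCompletion K, Valued.v c ≤ 1 →
        IwahoriCond (Fin 2) β γ (1 + Matrix.single (0 : Fin 2) (1 : Fin 2) c) := fun c hc => by
      refine ⟨fun i j => ?_, fun i j hij => ?_, fun i => ?_⟩
      · fin_cases i <;> fin_cases j <;> simp [hc]
      · fin_cases i <;> fin_cases j <;> simp at hij ⊢
      · fin_cases i <;> simp
    refine ⟨by simpa using hcond x hx, ?_⟩
    rw [localUnipotent_inv, coe_localUnipotent]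
    exact hcond (-x) (by rwa [Valuation.map_neg])

/-- An element of ALL the Iwahori subgroups `Iw_v(β, γ)` is a unipotent `n(x)` (take `β = γ = 0`).
[folklore] -/
theorem eq_localUnipotent_of_forall_mem {u : GL (Fin 2) (v.adicCompletion K)}
    (hu : ∀ β γ : WithZero (Multiplicative ℤ), u ∈ valuedIwahoriSubgroup (Fin 2) β γ) :
    u = localUnipotent v ((u : Matrix (Fin 2) (Fin 2) (v.adicCompletion K)) 0 1) := by
  have h := (hu 0 0).1
  have h10 : (u : Matrix (Fin 2) (Fin 2) (v.adicCompletion K)) 1 0 = 0 := by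
    have := h.lower 1 0 (by decide)
    rw [min_self, le_zero_iff, map_eq_zero] at this
    exact this
  have hdiag : ∀ i, (u : Matrix (Fin 2) (Fin 2) (v.adicCompletion K)) i i = 1 := fun i => by
    have := h.diag i
    rw [le_zero_iff, map_eq_zero, sub_eq_zero] at this
    exact this
  refine Matrix.GeneralLinearGroup.ext fun i j => ?_
  fin_cases i <;> fin_cases j <;> simp [h10, hdiag]

/-! ### The global unipotents `N(x) = ι_v(n(x))` at an Iwahori level `U(b,c)` -/

variable (K) in
/-- **`N(x) = ι_v(n(x)) ∈ GL₂(𝔸_K^∞)`**, the unipotent `n(x)` embedded at `v`. [folklore] -/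
def globalUnipotent (x : v.adicCompletion K) : FiniteAdelicGL 2 K :=
  ofLocal 2 K v (localUnipotent v x)

/-- `N(x) N(y) = N(x + y)`. [folklore] -/
theorem globalUnipotent_mul (x y : v.adicCompletion K) :
    globalUnipotent K v x * globalUnipotent K v y = globalUnipotent K v (x + y) := by
  rw [globalUnipotent, globalUnipotent, globalUnipotent, ← map_mul, localUnipotent_mul]

/-- `N(x)⁻¹ = N(-x)`. [folklore] -/
theorem globalUnipotent_inv (x : v.adicCompletion K) : (globalUnipotent K v x)⁻¹ = globalUnipotent K v (-x) := by
  rw [globalUnipotent, globalUnipotent, ← map_inv, localUnipotent_inv]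

/-- The `v`-component of `N(x)`. [folklore] -/
@[simp]
theorem localComponent_globalUnipotent (x : v.adicCompletion K) :
    localComponent 2 K v (globalUnipotent K v x) = localUnipotent v x :=
  localComponent_ofLocal _

/-- **`t_{v,1}^a = ι_v(diag(ϖ_v^a, 1))`.** [folklore] -/
theorem heckeElement_one_pow_eq_ofLocal (a : ℕ) :
    heckeElement 2 K v 1 ^ a = ofLocal 2 K v (cutDiag (uniformizerAt v ^ a) 1) := by
  rw [heckeElement_eq_ofLocal, ← map_pow, ← cutDiag_one_pow]
  rfl

/-- **`t^a N(x) = N(ϖ^a x) t^a`** (`t = t_{v,1}`). [folklore] -/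
theorem heckeElement_pow_mul_globalUnipotent (a : ℕ) (x : v.adicCompletion K) :
    heckeElement 2 K v 1 ^ a * globalUnipotent K v x =
      globalUnipotent K v (((uniformizerAt v ^ a : (v.adicCompletion K)ˣ) : v.adicCompletion K) * x) *
        heckeElement 2 K v 1 ^ a := by
  rw [heckeElement_one_pow_eq_ofLocal, globalUnipotent, globalUnipotent, ← map_mul, ← map_mul,
    cutDiag_mul_localUnipotent]

/-- **`t^{-a} N(x) t^a = N(ϖ^{-a} x)`.** [folklore] -/
theorem heckeElement_pow_inv_mul_globalUnipotent_mul (a : ℕ) (x : v.adicCompletion K) :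
    (heckeElement 2 K v 1 ^ a)⁻¹ * globalUnipotent K v x * heckeElement 2 K v 1 ^ a =
      globalUnipotent K v ((((uniformizerAt v ^ a)⁻¹ : (v.adicCompletion K)ˣ) : v.adicCompletion K) * x) := by
  rw [heckeElement_one_pow_eq_ofLocal, globalUnipotent, globalUnipotent, ← map_inv, ← map_mul, ← map_mul,
    cutDiag_inv_mul_localUnipotent_mul_cutDiag]

/-- `|ϖ_v| ≤ 1` (re-derived; the tree's copies are private). [folklore] -/
private theorem valued_uniformizerAt_le_one₀ :
    Valued.v ((uniformizerAt v : (v.adicCompletion K)ˣ) : v.adicCompletion K) ≤ 1 := by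
  rw [valued_coe_uniformizerAt, ← WithZero.exp_zero]
  exact WithZero.exp_le_exp.2 (by norm_num)

namespace TameLevel

variable {p : ℕ} [Fact p.Prime] (𝒰 : TameLevel 2 K p) {v}

/-- **`N(x) ∈ U(b,c)` iff `x` is integral** (`U` maximal above `p`, `v ∣ p`). [folklore] -/
theorem globalUnipotent_mem_level_iff (h𝒰 : 𝒰.IsMaximalAbove) (hv : (p : 𝓞 K) ∈ v.asIdeal)
    (b c : ℕ) (x : v.adicCompletion K) :
    globalUnipotent K v x ∈ 𝒰.level b c ↔ Valued.v x ≤ 1 := by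
  constructor
  · intro h
    have hloc := ((𝒰.mem_level_iff b c _).1 h).2 v hv
    rw [localComponent_globalUnipotent] at hloc
    exact (localUnipotent_mem_valuedIwahoriSubgroup_iff v x _ _).1 hloc
  · intro hx
    have hmem : localUnipotent v x ∈ iwahoriLevel 2 v b c :=
      (localUnipotent_mem_valuedIwahoriSubgroup_iff v x _ _).2 hx
    exact 𝒰.ofLocal_mem_levelAt h𝒰 hv (valuedIwahoriSubgroup_le_valuedCongruenceSubgroup_one hmem)
      (Λ := fun w => iwahoriLevel 2 w.1 b c) hmem

/-- **Every coset of `U t^a U / U` is `N(x) t^a U`** (`U = U(b,c)`, `a ≤ c`): from the Iwahori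
factorisation `l_v = n(x) · (t^a m t^{-a})`, `m ∈ Iw_v(b,c)` (`exists_unipotent_cutDiag_conj_mem`).
[cite: KhareThorne2017, §6.2, proof of Lemma 6.5] -/
theorem exists_globalUnipotent_coset_eq (h𝒰 : 𝒰.IsMaximalAbove) (hv : (p : 𝓞 K) ∈ v.asIdeal)
    {b c a : ℕ} (ha : a ≤ c) {l : FiniteAdelicGL 2 K} (hl : l ∈ 𝒰.level b c) :
    ∃ x : v.adicCompletion K, Valued.v x ≤ 1 ∧
      ((l * heckeElement 2 K v 1 ^ a : FiniteAdelicGL 2 K) : FiniteAdelicGL 2 K ⧸ 𝒰.level b c) =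
        ((globalUnipotent K v x * heckeElement 2 K v 1 ^ a : FiniteAdelicGL 2 K) :
          FiniteAdelicGL 2 K ⧸ 𝒰.level b c) := by
  have hlv : localComponent 2 K v l ∈ iwahoriLevel 2 v b c := ((𝒰.mem_level_iff b c l).1 hl).2 v hv
  set w : (v.adicCompletion K)ˣ := uniformizerAt v ^ a with hw
  have hvw : Valued.v (w : v.adicCompletion K) = WithZero.exp (-(a : ℤ)) := by
    rw [hw, Units.val_pow_eq_pow_val, map_pow, valued_coe_uniformizerAt, ← WithZero.exp_nsmul]
    simp
  have hϖ : Valued.v (w : v.adicCompletion K) ≤ 1 := by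
    rw [hvw, ← WithZero.exp_zero]
    exact WithZero.exp_le_exp.2 (by omega)
  have hγ : min (WithZero.exp (-(b : ℤ)) : WithZero (Multiplicative ℤ)) (WithZero.exp (-(c : ℤ))) ≤
      Valued.v (w : v.adicCompletion K) := by
    rw [hvw]
    exact (min_le_right _ _).trans (WithZero.exp_le_exp.2 (by omega))
  obtain ⟨u, hu, hconj⟩ := exists_unipotent_cutDiag_conj_mem hϖ hγ 1 hlv
  set x : v.adicCompletion K := (u : Matrix (Fin 2) (Fin 2) (v.adicCompletion K)) 0 1 with hx
  have hux : u = localUnipotent v x := eq_localUnipotent_of_forall_mem v hu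
  have hx1 : Valued.v x ≤ 1 := by
    have h := hu 1 1
    rw [hux] at h
    exact (localUnipotent_mem_valuedIwahoriSubgroup_iff v x _ _).1 h
  refine ⟨x, hx1, ?_⟩
  -- `(N(x) t^a)⁻¹ (l t^a) = t^{-a} (N(x)⁻¹ l) t^a ∈ U`
  symm
  rw [QuotientGroup.eq]
  have hy : (globalUnipotent K v x)⁻¹ * l ∈ 𝒰.level b c :=
    mul_mem (inv_mem ((𝒰.globalUnipotent_mem_level_iff h𝒰 hv b c x).2 hx1)) hl
  have key : (ofLocal 2 K v (cutDiag w 1))⁻¹ * ((globalUnipotent K v x)⁻¹ * l) * ofLocal 2 K v (cutDiag w 1) ∈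
      𝒰.level b c := by
    refine 𝒰.ofLocal_inv_mul_mul_ofLocal_mem_levelAt h𝒰 hv (Λ := fun w => iwahoriLevel 2 w.1 b c)
      valuedIwahoriSubgroup_le_valuedCongruenceSubgroup_one hy ?_
    rw [map_mul, map_inv, localComponent_globalUnipotent, ← hux]
    exact hconj
  have heq : (globalUnipotent K v x * heckeElement 2 K v 1 ^ a)⁻¹ * (l * heckeElement 2 K v 1 ^ a) =
      (ofLocal 2 K v (cutDiag w 1))⁻¹ * ((globalUnipotent K v x)⁻¹ * l) * ofLocal 2 K v (cutDiag w 1) := by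
    rw [heckeElement_one_pow_eq_ofLocal, ← hw]
    group
  rw [heq]
  exact key

/-- **`N(x) t^a U = N(x') t^a U ↔ v(x' − x) ≤ |ϖ_v|^a`** (`U = U(b,c)`). [folklore] -/
theorem globalUnipotent_coset_eq_iff (h𝒰 : 𝒰.IsMaximalAbove) (hv : (p : 𝓞 K) ∈ v.asIdeal)
    (b c a : ℕ) (x x' : v.adicCompletion K) :
    ((globalUnipotent K v x * heckeElement 2 K v 1 ^ a : FiniteAdelicGL 2 K) :
        FiniteAdelicGL 2 K ⧸ 𝒰.level b c) =
      ((globalUnipotent K v x' * heckeElement 2 K v 1 ^ a : FiniteAdelicGL 2 K) :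
        FiniteAdelicGL 2 K ⧸ 𝒰.level b c) ↔
      Valued.v (x' - x) ≤ Valued.v ((uniformizerAt v : (v.adicCompletion K)ˣ) : v.adicCompletion K) ^ a := by
  rw [QuotientGroup.eq]
  have heq : (globalUnipotent K v x * heckeElement 2 K v 1 ^ a)⁻¹ *
      (globalUnipotent K v x' * heckeElement 2 K v 1 ^ a) =
      (heckeElement 2 K v 1 ^ a)⁻¹ * globalUnipotent K v (x' - x) * heckeElement 2 K v 1 ^ a := by
    rw [mul_inv_rev, globalUnipotent_inv, show x' - x = -x + x' by ring, ← globalUnipotent_mul]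
    group
  rw [heq, heckeElement_pow_inv_mul_globalUnipotent_mul, 𝒰.globalUnipotent_mem_level_iff h𝒰 hv,
    map_mul, map_units_inv, Units.val_pow_eq_pow_val, map_pow]
  have hpos : 0 < Valued.v ((uniformizerAt v : (v.adicCompletion K)ˣ) : v.adicCompletion K) ^ a := by
    rw [valued_coe_uniformizerAt, ← WithZero.exp_nsmul]
    exact WithZero.exp_pos
  rw [inv_mul_le_iff₀ hpos, mul_one]

/-- **`t^a U t^b ⊆ U t^{a+b} U`** at `U = U(b', c)` for `b ≤ c`:
`t^a l t^b U = N(ϖ^a y) t^{a+b} U` with `l t^b U = N(y) t^b U`. [folklore] -/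
theorem heckeElement_pow_mul_mul_mem_doubleCosetQuot (h𝒰 : 𝒰.IsMaximalAbove) (hv : (p : 𝓞 K) ∈ v.asIdeal)
    {b' c a b : ℕ} (hb : b ≤ c) (l : FiniteAdelicGL 2 K) (hl : l ∈ 𝒰.level b' c) :
    ((heckeElement 2 K v 1 ^ a * l * heckeElement 2 K v 1 ^ b : FiniteAdelicGL 2 K) :
        FiniteAdelicGL 2 K ⧸ 𝒰.level b' c) ∈
      ArithmeticQuotient.doubleCosetQuot (𝒰.level b' c) (heckeElement 2 K v 1 ^ a * heckeElement 2 K v 1 ^ b) := by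
  obtain ⟨y, hy1, hy⟩ := 𝒰.exists_globalUnipotent_coset_eq h𝒰 hv hb hl
  set w : v.adicCompletion K := ((uniformizerAt v ^ a : (v.adicCompletion K)ˣ) : v.adicCompletion K) with hw
  have hwy : Valued.v (w * y) ≤ 1 := by
    rw [map_mul, hw, Units.val_pow_eq_pow_val, map_pow]
    exact mul_le_one' (pow_le_one' (valued_uniformizerAt_le_one₀ v) a) hy1
  have h1 : ((heckeElement 2 K v 1 ^ a * l * heckeElement 2 K v 1 ^ b : FiniteAdelicGL 2 K) :
      FiniteAdelicGL 2 K ⧸ 𝒰.level b' c) =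
      (heckeElement 2 K v 1 ^ a : FiniteAdelicGL 2 K) •
        ((l * heckeElement 2 K v 1 ^ b : FiniteAdelicGL 2 K) : FiniteAdelicGL 2 K ⧸ 𝒰.level b' c) := by
    rw [MulAction.Quotient.smul_coe, smul_eq_mul, mul_assoc]
  rw [h1, hy, MulAction.Quotient.smul_coe, smul_eq_mul, ← mul_assoc, heckeElement_pow_mul_globalUnipotent,
    mul_assoc]
  change ((globalUnipotent K v (w * y) : FiniteAdelicGL 2 K)) •
      (((heckeElement 2 K v 1 ^ a * heckeElement 2 K v 1 ^ b : FiniteAdelicGL 2 K)) :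
        FiniteAdelicGL 2 K ⧸ 𝒰.level b' c) ∈ _
  exact ArithmeticQuotient.coe_smul_mem_doubleCosetQuot (MulAction.mem_orbit_self _)
    ⟨globalUnipotent K v (w * y), (𝒰.globalUnipotent_mem_level_iff h𝒰 hv b' c _).2 hwy⟩

/-- **Separation**: if `y • e = y' • e'` with `yU, y'U ∈ U t^a U / U` and `e, e' ∈ U t^b U / U`
(`U = U(b', c)`, `a + b ≤ c`), then `yU = y'U` — from `N(x) t^a N(z) t^b U = N(x + ϖ^a z) t^{a+b} U`
and `v(x − x') ≤ max(|ϖ|^{a+b}, |ϖ|^a) = |ϖ|^a`. [folklore] -/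
theorem coe_eq_coe_of_smul_eq_smul (h𝒰 : 𝒰.IsMaximalAbove) (hv : (p : 𝓞 K) ∈ v.asIdeal)
    {b' c a b : ℕ} (hab : a + b ≤ c) (y y' : FiniteAdelicGL 2 K)
    (hy : (y : FiniteAdelicGL 2 K ⧸ 𝒰.level b' c) ∈
      ArithmeticQuotient.doubleCosetQuot (𝒰.level b' c) (heckeElement 2 K v 1 ^ a))
    (hy' : (y' : FiniteAdelicGL 2 K ⧸ 𝒰.level b' c) ∈
      ArithmeticQuotient.doubleCosetQuot (𝒰.level b' c) (heckeElement 2 K v 1 ^ a))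
    (e : FiniteAdelicGL 2 K ⧸ 𝒰.level b' c)
    (he : e ∈ ArithmeticQuotient.doubleCosetQuot (𝒰.level b' c) (heckeElement 2 K v 1 ^ b))
    (e' : FiniteAdelicGL 2 K ⧸ 𝒰.level b' c)
    (he' : e' ∈ ArithmeticQuotient.doubleCosetQuot (𝒰.level b' c) (heckeElement 2 K v 1 ^ b))
    (hee : y • e = y' • e') :
    (y : FiniteAdelicGL 2 K ⧸ 𝒰.level b' c) = (y' : FiniteAdelicGL 2 K ⧸ 𝒰.level b' c) := by
  have ha : a ≤ c := by omega
  have hb : b ≤ c := by omega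
  set t : FiniteAdelicGL 2 K := heckeElement 2 K v 1 with ht
  set w : v.adicCompletion K := ((uniformizerAt v ^ a : (v.adicCompletion K)ˣ) : v.adicCompletion K) with hw
  -- normal form of `y • e` for `yU ∈ U t^a U/U`, `e ∈ U t^b U/U`
  have normal : ∀ (z : FiniteAdelicGL 2 K), (z : FiniteAdelicGL 2 K ⧸ 𝒰.level b' c) ∈
      ArithmeticQuotient.doubleCosetQuot (𝒰.level b' c) (t ^ a) → ∀ d ∈ ArithmeticQuotient.doubleCosetQuot (𝒰.level b' c) (t ^ b),
      ∃ x x₂ : v.adicCompletion K, Valued.v x ≤ 1 ∧ Valued.v x₂ ≤ 1 ∧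
        (z : FiniteAdelicGL 2 K ⧸ 𝒰.level b' c) = ((globalUnipotent K v x * t ^ a : FiniteAdelicGL 2 K) : FiniteAdelicGL 2 K ⧸ 𝒰.level b' c) ∧
        z • d = ((globalUnipotent K v (x + w * x₂) * t ^ (a + b) : FiniteAdelicGL 2 K) : FiniteAdelicGL 2 K ⧸ 𝒰.level b' c) := by
    intro z hz d hd
    obtain ⟨l, hl, hlz⟩ := ArithmeticQuotient.exists_coe_mul_eq_of_mem_doubleCosetQuot (𝒰.level b' c) hz
    obtain ⟨x, hx1, hx⟩ := 𝒰.exists_globalUnipotent_coset_eq h𝒰 hv ha hl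
    -- `z = N(x) t^a u₀` with `u₀ ∈ U`
    have hzx : (z : FiniteAdelicGL 2 K ⧸ 𝒰.level b' c) = ((globalUnipotent K v x * t ^ a : FiniteAdelicGL 2 K) : FiniteAdelicGL 2 K ⧸ 𝒰.level b' c) := by
      rw [← hlz, hx]
    have hu₀ : (globalUnipotent K v x * t ^ a)⁻¹ * z ∈ 𝒰.level b' c := QuotientGroup.eq.1 hzx.symm
    set u₀ := (globalUnipotent K v x * t ^ a)⁻¹ * z with hu₀_def
    have hz_eq : z = globalUnipotent K v x * t ^ a * u₀ := by rw [hu₀_def]; group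
    obtain ⟨l', hl', hld⟩ := ArithmeticQuotient.exists_coe_mul_eq_of_mem_doubleCosetQuot (𝒰.level b' c) hd
    -- `(u₀ l') t^b U = N(x₂) t^b U`
    obtain ⟨x₂, hx₂1, hx₂⟩ := 𝒰.exists_globalUnipotent_coset_eq h𝒰 hv hb (mul_mem hu₀ hl')
    refine ⟨x, x₂, hx1, hx₂1, hzx, ?_⟩
    rw [← hld, MulAction.Quotient.smul_coe, smul_eq_mul, hz_eq,
      show globalUnipotent K v x * t ^ a * u₀ * (l' * t ^ b) =
        (globalUnipotent K v x * t ^ a) * (u₀ * l' * t ^ b) by group]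
    change ((globalUnipotent K v x * t ^ a : FiniteAdelicGL 2 K)) •
        (((u₀ * l' * t ^ b : FiniteAdelicGL 2 K)) : FiniteAdelicGL 2 K ⧸ 𝒰.level b' c) = _
    rw [hx₂, MulAction.Quotient.smul_coe, smul_eq_mul,
      show globalUnipotent K v x * t ^ a * (globalUnipotent K v x₂ * t ^ b) =
        globalUnipotent K v x * (t ^ a * globalUnipotent K v x₂) * t ^ b by group,
      heckeElement_pow_mul_globalUnipotent, ← hw, ← mul_assoc, globalUnipotent_mul, mul_assoc, ← pow_add]
  obtain ⟨x, x₂, hx1, hx₂1, hyx, hye⟩ := normal y hy e he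
  obtain ⟨x', x₂', hx1', hx₂1', hyx', hye'⟩ := normal y' hy' e' he'
  rw [hyx, hyx', 𝒰.globalUnipotent_coset_eq_iff h𝒰 hv]
  have hsum := (𝒰.globalUnipotent_coset_eq_iff h𝒰 hv b' c (a + b) _ _).1 (hye.symm.trans (hee.trans hye'))
  -- `x' - x = (x' + w x₂' - (x + w x₂)) - w (x₂' - x₂)`
  have hϖ1 := valued_uniformizerAt_le_one₀ v
  have hwv : Valued.v w = Valued.v ((uniformizerAt v : (v.adicCompletion K)ˣ) : v.adicCompletion K) ^ a := by
    rw [hw, Units.val_pow_eq_pow_val, map_pow]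
  have hdecomp : x' - x = (x' + w * x₂' - (x + w * x₂)) - w * (x₂' - x₂) := by ring
  rw [hdecomp]
  refine (Valuation.map_sub _ _ _).trans (max_le (hsum.trans ?_) ?_)
  · exact pow_le_pow_right_of_le_one' hϖ1 (Nat.le_add_right a b)
  · rw [map_mul, hwv]
    exact mul_le_of_le_one_right' ((Valuation.map_sub _ _ _).trans (max_le hx₂1' hx₂1))

/-- **`[U t^a U] ∘ [U t^b U] = [U t^{a+b} U]` on `Fun(GL₂(𝔸_K^∞) ⧸ U(b',c), M)`** for `a + b ≤ c`
(`U` maximal above `p`, `v ∣ p`, `t = t_{v,1}`). [cite: ShimuraIATAF1971, Ch. 3, Prop. 3.3]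
[cite: KhareThorne2017, §6.2] -/
theorem heckeFun_level_heckeElement_pow_comp (k : Type) [CommRing k] (M : Type) [AddCommGroup M]
    [Module k M] (h𝒰 : 𝒰.IsMaximalAbove) (hv : (p : 𝓞 K) ∈ v.asIdeal) {b' c a b : ℕ} (hab : a + b ≤ c) :
    ArithmeticQuotient.heckeFun k (𝒰.level b' c) (heckeElement 2 K v 1 ^ a) M ∘ₗ
        ArithmeticQuotient.heckeFun k (𝒰.level b' c) (heckeElement 2 K v 1 ^ b) M =
      ArithmeticQuotient.heckeFun k (𝒰.level b' c) (heckeElement 2 K v 1 ^ (a + b)) M := by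
  rw [pow_add]
  exact ArithmeticQuotient.heckeFun_comp_heckeFun k (𝒰.level b' c) M (finite_orbit_quotient (𝒰.level b' c) _)
    (finite_orbit_quotient (𝒰.level b' c) _) (finite_orbit_quotient (𝒰.level b' c) _)
    (fun l hl => 𝒰.heckeElement_pow_mul_mul_mem_doubleCosetQuot h𝒰 hv (by omega) l hl)
    (fun y y' hy hy' e he e' he' hee => 𝒰.coe_eq_coe_of_smul_eq_smul h𝒰 hv hab y y' hy hy' e he e' he' hee)

/-- **`[U t^r U] = [U t U]^r` on `Fun(GL₂(𝔸_K^∞) ⧸ U(b',c), M)`** for `r ≤ c`. [folklore] -/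
theorem heckeFun_level_heckeElement_pow (k : Type) [CommRing k] (M : Type) [AddCommGroup M]
    [Module k M] (h𝒰 : 𝒰.IsMaximalAbove) (hv : (p : 𝓞 K) ∈ v.asIdeal) {b' c r : ℕ} (hr : r ≤ c) :
    ArithmeticQuotient.heckeFun k (𝒰.level b' c) (heckeElement 2 K v 1 ^ r) M =
      ArithmeticQuotient.heckeFun k (𝒰.level b' c) (heckeElement 2 K v 1) M ^ r := by
  induction r with
  | zero => rw [pow_zero, pow_zero, ArithmeticQuotient.heckeFun_one, Module.End.one_eq_id]
  | succ r ih =>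
    have h := 𝒰.heckeFun_level_heckeElement_pow_comp k M h𝒰 hv (b' := b') (show r + 1 ≤ c from hr)
    rw [← h, pow_one, ih (by omega), pow_succ, Module.End.mul_eq_comp]

/-- **On `H^i(X_{U(b',c)}, M)`: `heckeEnd (t_{v,1}^a) * heckeEnd (t_{v,1}^b) = heckeEnd (t_{v,1}^{a+b})`**
for `a + b ≤ c`. [cite: ShimuraIATAF1971, Ch. 3, Prop. 3.3] -/
theorem heckeEnd_level_heckeElement_pow_mul (k : Type) [CommRing k] (M : Type) [AddCommGroup M]
    [Module k M] {Γ : Type} [Group Γ] (ι : Γ →* FiniteAdelicGL 2 K) (h𝒰 : 𝒰.IsMaximalAbove)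
    (hv : (p : 𝓞 K) ∈ v.asIdeal) {b' c a b : ℕ} (hab : a + b ≤ c) (i : ℕ) :
    ArithmeticQuotient.heckeEnd k (𝒰.level b' c) (heckeElement 2 K v 1 ^ a) M ι i *
        ArithmeticQuotient.heckeEnd k (𝒰.level b' c) (heckeElement 2 K v 1 ^ b) M ι i =
      ArithmeticQuotient.heckeEnd k (𝒰.level b' c) (heckeElement 2 K v 1 ^ (a + b)) M ι i := by
  have hrep : ArithmeticQuotient.heckeRepHom k (𝒰.level b' c) (heckeElement 2 K v 1 ^ (a + b)) M ι =
      ArithmeticQuotient.heckeRepHom k (𝒰.level b' c) (heckeElement 2 K v 1 ^ b) M ι ≫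
        ArithmeticQuotient.heckeRepHom k (𝒰.level b' c) (heckeElement 2 K v 1 ^ a) M ι :=
    Rep.hom_ext (Representation.IntertwiningMap.ext
      (𝒰.heckeFun_level_heckeElement_pow_comp k M h𝒰 hv hab).symm)
  rw [ArithmeticQuotient.heckeEnd, ArithmeticQuotient.heckeEnd, ArithmeticQuotient.heckeEnd,
    ArithmeticQuotient.heckeOperator, ArithmeticQuotient.heckeOperator, ArithmeticQuotient.heckeOperator, hrep,
    groupCohomology.map_id_comp, Module.End.mul_eq_comp, ModuleCat.hom_comp]

/-- **On `H^i(X_{U(b',c)}, M)`: `heckeEnd (t_{v,1}^r) = (heckeEnd t_{v,1})^r = U_{v,1}^r`** for `r ≤ c` —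
the operator `U_v^{(r)}` of independence of weight is the `r`-th power of the tree's `U_{v,1}`.
[cite: KhareThorne2017, §6.4] -/
theorem heckeEnd_level_heckeElement_pow (k : Type) [CommRing k] (M : Type) [AddCommGroup M]
    [Module k M] {Γ : Type} [Group Γ] (ι : Γ →* FiniteAdelicGL 2 K) (h𝒰 : 𝒰.IsMaximalAbove)
    (hv : (p : 𝓞 K) ∈ v.asIdeal) {b' c r : ℕ} (hr : r ≤ c) (i : ℕ) :
    ArithmeticQuotient.heckeEnd k (𝒰.level b' c) (heckeElement 2 K v 1 ^ r) M ι i =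
      ArithmeticQuotient.heckeEnd k (𝒰.level b' c) (heckeElement 2 K v 1) M ι i ^ r := by
  induction r with
  | zero =>
    rw [pow_zero, pow_zero]
    exact ArithmeticQuotient.heckeEnd_one k ι (𝒰.level b' c) M i
  | succ r ih =>
    rw [← 𝒰.heckeEnd_level_heckeElement_pow_mul k M ι h𝒰 hv (show r + 1 ≤ c from hr) i, pow_one, ih (by omega),
      pow_succ]

/-- Consequently the `U_v^{(r)}`-ordinary part is the `U_{v,1}`-ordinary part:
`⋂ₙ range (heckeEnd t^r)ⁿ = ⋂ₙ range (heckeEnd t)ⁿ` for `1 ≤ r ≤ c`. [folklore] -/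
theorem iInf_range_heckeEnd_level_heckeElement_pow (k : Type) [CommRing k] (M : Type) [AddCommGroup M]
    [Module k M] {Γ : Type} [Group Γ] (ι : Γ →* FiniteAdelicGL 2 K) (h𝒰 : 𝒰.IsMaximalAbove)
    (hv : (p : 𝓞 K) ∈ v.asIdeal) {b' c r : ℕ} (hr1 : 1 ≤ r) (hr : r ≤ c) (i : ℕ) :
    (⨅ n : ℕ, LinearMap.range (ArithmeticQuotient.heckeEnd k (𝒰.level b' c) (heckeElement 2 K v 1 ^ r) M ι i ^ n)) =
      ⨅ n : ℕ, LinearMap.range (ArithmeticQuotient.heckeEnd k (𝒰.level b' c) (heckeElement 2 K v 1) M ι i ^ n) := by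
  rw [𝒰.heckeEnd_level_heckeElement_pow k M ι h𝒰 hv hr i]
  set T := ArithmeticQuotient.heckeEnd k (𝒰.level b' c) (heckeElement 2 K v 1) M ι i with hT
  refine le_antisymm (le_iInf fun n => (iInf_le _ n).trans ?_) (le_iInf fun n => (iInf_le _ (r * n)).trans ?_)
  · -- `range (T^r)^n = range T^{rn} ≤ range T^n`
    rw [← pow_mul]
    rintro _ ⟨y, rfl⟩
    refine ⟨(T ^ (r * n - n)) y, ?_⟩
    rw [← Module.End.mul_apply, ← pow_add, Nat.add_sub_cancel' (Nat.le_mul_of_pos_left n hr1)]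
  · rw [← pow_mul]

end TameLevel

end BigHeckeGLn

end Literature.NumberTheory.Automorphic
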